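import Summits.Ventures.YMGap.Thresholds.TruncatedSplitDim
import Summits.Ventures.YMGap.Thresholds.TruncatedTreeDecay
import Summits.Ventures.YMGap.Thresholds.CouplingDerivativeSeriesDim
import HarnessLib

/-!
# Venture YMGap — C-SMOOTH in every dimension (i): TREE DECAY OF THE TRUNCATED FUNCTIONS OF EVERY ORDER of the `SU(N)`
# strong-coupling state on `ℤ^d` under the one-link modulus hypotheses, constants uniform in the coupling

HONEST FRAMING: venture file of the cell `pub-ymgap` (QuantumFields programme), seat ds-1 (gen 12).  Every-`d` twin of
`TruncatedTreeDecaySUN` (tree coupling `0 ≤ b ≤ b₁`, modulus `OneLinkKRModulus N R Kc`, `2(d−1) b₁/N ≤ R`, door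
`P_d(Kc b₁/N) < 1`); cumulant estimates of the unique DLR state only; nothing about the continuum, confinement at weak
coupling, or the Clay problem.

* ★★ `exists_truncated_tree_bound_dim` — ONE `(A, ρ)` per order: `|u_{n+1}(F; W_{q 0}; …)| ≤ A ∏_i ρ^{‖x₀ − x_{q i}‖₁}`,
  `ρ = exp(−κ_d/(d(n+1)²))`; ★ `summable_truncated_dim` (`Σ'|u_{n+1}| ≤ A Zⁿ`, `Z = D_d((1+ρ)/(1−ρ))^d`);
  ★ `tsum_abs_truncated_snoc_le_dim`.
-/

noncomputable section

open MeasureTheory ProbabilityTheory Function Finset Filter Topology Real Set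
open scoped NNReal
open Literature.MathematicalPhysics.QuantumLattice (LGConfig ZdEdge ZdPlaquette plaquetteEdges fundamentalRep
  fundamentalRep_mem_unitaryGroup ymGibbsMeasures)
open Literature.MathematicalPhysics.QuantumFieldTheory hiding ZdEdge
open Literature.MathematicalPhysics.QuantumFieldTheory.Balaban1983to89.StrongCouplingDobrushinWindow (OneLinkKRModulus)
open Literature.Probability.LatticeModels (Site Site.supNorm Site.norm_eq_supNorm Site.supNorm_eq_zero_iff)
open Summit.Ventures.YMGap.StarResolventDim (gaugeR doorPoly)
open Summit.Ventures.YMGap.RobustBall (l1 numOrient)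
open Summit.Ventures.YMGap.LinearResponseBound (summable_and_tsum_base_le)
open Summit.Ventures.YMGap.PlaquetteSusceptibility (l1_le_mul_norm)
open Summit.Ventures.YMGap.Cumulants

namespace Summit.Ventures.YMGap.CouplingResponse

variable {d N : ℕ}

/-- Local shorthand: the normalised plaquette observable `W_q = (1/N) Re tr U_q` of `SU(N)` on `ℤ^d`, as a family. -/
local notation3 (prettyPrint := false) "𝓦" =>
  fun q : ZdPlaquette d => zdPlaquetteObs (d := d) (fundamentalRep (Fin N)) (Prod.fst q) (Prod.snd q).1.1 (Prod.snd q).1.2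

/-- Local shorthand: the any-`d` Dobrushin–Shlosman rate `κ_d(R_G^{(d)}(c))`. -/
local notation3 (prettyPrint := false) "dimκ(" d' ", " c ")" =>
  (1 - gaugeR d' c) ^ 2 / (2 * (2 * gaugeR d' c * ((2 * d' : ℕ) : ℝ) + 1))

set_option maxHeartbeats 400000 in
/-- ★★ **TREE DECAY OF THE TRUNCATED FUNCTIONS OF EVERY ORDER, ONE CONSTANT FOR THE WINDOW** (`SU(N)` on `ℤ^d`, under the
one-link modulus hypotheses `OneLinkKRModulus N R Kc`, `2(d−1)b₁/N ≤ R`, `P_d(Kc b₁/N) < 1`).  For a Lipschitz cylinder `F` (support `Λ`, constant `K`, links within `D` of `x₀`)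
and every order `n` there are `A ≥ 0` and `0 ≤ ρ < 1` such that for EVERY `0 ≤ b ≤ b₁`, every DLR state `μ` at
tree coupling `b` and every `n`-tuple of plaquettes `q`:
`|u_{n+1}(F; W_{q 0}; …; W_{q (n−1)})_μ| ≤ A · ∏_i ρ^{‖x₀ − x_{q i}‖₁}`.
Proof: the split lemma `abs_ac_le_of_split` at the pigeonhole cut `exists_gap` (gap `g ≥ R/n`,
`R = max_i ‖x_{q i} − x₀‖_∞`) with the one-split estimate `abs_mom_sub_mom_mul_mom_le_dim`, and
`e^{−κ g} ≤ ∏_i e^{−κ‖x_{q i} − x₀‖₁/(d(n+1)²)}`; explicitly `ρ = exp(−κ/(d(n+1)²))`, `κ = κ_d(R_G^{(d)}(Kc b₁/N))`, and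
`A = cumBound(n+1) B₀^{n+1} (1 + 4(2√N)² e^{κ(2D+6)} ((n+1)² (#Λ+4)(K+4N³) B₀^{n+1})²)`, `B₀ = |F 1| + 2K + 1`. -/
theorem exists_truncated_tree_bound_dim (hd : 2 ≤ d) (hN : 1 ≤ N) {R Kc b₁ : ℝ} (hK0 : 0 ≤ Kc)
    (hmod : OneLinkKRModulus N R Kc) (hR : b₁ / N * (2 * ((d : ℝ) - 1)) ≤ R) (hdoor : doorPoly d (Kc * (b₁ / N)) < 1)
    {F : LGConfig d (Matrix.specialUnitaryGroup (Fin N) ℂ) → ℝ} {Λ : Finset (ZdEdge d)} {K : ℝ≥0}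
    (hF : IsLipschitzCylinder (fundamentalRep (Fin N)) F Λ K)
    {x₀ : Site d} {D : ℕ} (hD : ∀ e ∈ Λ, ‖e.1 - x₀‖ ≤ D) (n : ℕ) :
    ∃ A ρ : ℝ, 0 ≤ A ∧ 0 ≤ ρ ∧ ρ < 1 ∧ ∀ ⦃b : ℝ⦄, 0 ≤ b → b ≤ b₁ →
      ∀ ⦃μ : Measure (LGConfig d (Matrix.specialUnitaryGroup (Fin N) ℂ))⦄,
        μ ∈ ymGibbsMeasures (d := d) (fundamentalRep (Fin N)) b →
      ∀ q : Fin n → ZdPlaquette d, |trunc μ F 𝓦 q| ≤ A * ∏ i, ρ ^ l1 (x₀ - (q i).1) := by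
  classical
  rcases lt_or_ge b₁ 0 with hneg | hβ₁0
  · exact ⟨0, 0, le_rfl, le_rfl, zero_lt_one, fun b h0 hb => absurd (h0.trans hb) (not_le.2 hneg)⟩
  have hN0 : (0 : ℝ) < N := by exact_mod_cast (show 0 < N by omega)
  have hd0 : (0 : ℝ) < d := by exact_mod_cast (show 0 < d by omega)
  have hb₁N : 0 ≤ b₁ / N := div_nonneg hβ₁0 hN0.le
  obtain ⟨hgr0, hgr1⟩ := gaugeR_dim_coef_lt_one (N := N) hd hK0 hb₁N hdoor
  have hκ : 0 < dimκ(d, Kc * (b₁ / N)) := StarDimLimit.dimRate_pos (d := d) hgr0 hgr1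
  set κ := dimκ(d, Kc * (b₁ / N)) with hκdef
  set K₀ : ℝ≥0 := K + 4 * (N : ℝ≥0) ^ 3 with hK₀
  set B₀ : ℝ≥0 := ‖F 1‖₊ + 2 * K + 1 with hB₀
  set c₀ : ℕ := Λ.card + 4 with hc₀
  set D' : ℕ := D + 1 with hD'
  have hB1 : (1 : ℝ≥0) ≤ B₀ := by rw [hB₀]; exact le_add_self
  have hB1r : (1 : ℝ) ≤ B₀ := by exact_mod_cast hB1
  set C₀ : ℝ := 4 * (2 * Real.sqrt N) ^ 2 with hC₀
  set Q : ℝ := (((n + 1 : ℕ) : ℝ) ^ 2 * c₀ * K₀ * (B₀ : ℝ) ^ (n + 1)) ^ 2 with hQ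
  set A : ℝ := cumBound (n + 1) * (B₀ : ℝ) ^ (n + 1) *
    (1 + C₀ * Real.exp (κ * (((2 * D' : ℕ) : ℝ) + 4)) * Q) with hA
  set ρ : ℝ := Real.exp (-(κ / ((d : ℝ) * ((n : ℝ) + 1) ^ 2))) with hρ
  have hρ0 : 0 ≤ ρ := (Real.exp_pos _).le
  have hc4 : 0 < κ / ((d : ℝ) * ((n : ℝ) + 1) ^ 2) := by positivity
  have hρ1 : ρ < 1 := Real.exp_lt_one_iff.2 (by linarith)
  have hQ0 : 0 ≤ Q := by positivity
  have hcb := (cumBound_pos (n + 1)).le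
  have hA0 : 0 ≤ A := by positivity
  refine ⟨A, ρ, hA0, hρ0, hρ1, fun b h0 hb μ hμ q => ?_⟩
  haveI : IsProbabilityMeasure μ := hμ.1
  -- slot data
  choose Λs cs hL hM hc hnear hcs0 hcsq using slot_data_dim (N := N) (d := d) hF hD q
  set S : Finset ℕ := Finset.range (n + 1) with hS
  have hcard : S.card = n + 1 := by rw [hS, Finset.card_range]
  have hmomb : ∀ T ⊆ S, |mom μ (slots F 𝓦 q) T| ≤ ∏ _i ∈ T, (B₀ : ℝ) :=
    abs_mom_le μ (b := fun _ => (B₀ : ℝ)) (fun i _ U => hM i U)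
  have hmom1 : mom μ (slots F 𝓦 q) ∅ = 1 := mom_empty μ _
  have hprodS : ∏ _i ∈ S, (B₀ : ℝ) = (B₀ : ℝ) ^ (n + 1) := by rw [Finset.prod_const, hcard]
  -- the crude bound, valid always
  have hcrude : |trunc μ F 𝓦 q| ≤ cumBound (n + 1) * (B₀ : ℝ) ^ (n + 1) := by
    have h := abs_ac_le (b := fun _ => (B₀ : ℝ)) (fun _ => B₀.2) hmomb 0 (subset_rfl : S ⊆ S)
    rw [hprodS, hcard] at h
    exact h
  -- distances of the plaquettes from `x₀`
  set dq : Fin n → ℕ := fun i => Site.supNorm ((q i).1 - x₀) with hdq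
  have hl1 : ∀ i, (l1 (x₀ - (q i).1) : ℝ) ≤ (d : ℝ) * dq i := fun i => by
    have h := l1_le_mul_norm (d := d) (x₀ - (q i).1)
    rw [norm_sub_rev, Site.norm_eq_supNorm] at h
    exact_mod_cast h
  have hprod0 : 0 ≤ ∏ i, ρ ^ l1 (x₀ - (q i).1) := Finset.prod_nonneg fun i _ => pow_nonneg hρ0 _
  have hAge : cumBound (n + 1) * (B₀ : ℝ) ^ (n + 1) ≤ A := by
    rw [hA]
    exact le_mul_of_one_le_right (by positivity) (le_add_of_nonneg_right (by positivity))
  by_cases hR0 : ∀ i, dq i = 0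
  · -- all plaquettes at `x₀`: the crude bound is the claim
    have hone : ∏ i, ρ ^ l1 (x₀ - (q i).1) = 1 := by
      refine Finset.prod_eq_one fun i _ => ?_
      have h' : (l1 (x₀ - (q i).1) : ℝ) ≤ 0 := by simpa [hR0 i] using hl1 i
      have h'' : l1 (x₀ - (q i).1) = 0 := Nat.le_zero.1 (by exact_mod_cast h')
      rw [h'', pow_zero]
    rw [hone, mul_one]
    exact hcrude.trans hAge
  · -- a plaquette away from `x₀`: pigeonhole cut
    obtain ⟨i₁, hi₁⟩ := not_forall.1 hR0
    have hne : (Finset.univ : Finset (Fin n)).Nonempty := ⟨i₁, Finset.mem_univ _⟩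
    set R : ℕ := Finset.univ.sup dq with hRdef
    have hdR : ∀ i, dq i ≤ R := fun i => Finset.le_sup (f := dq) (Finset.mem_univ i)
    obtain ⟨i₀, -, hi₀⟩ := Finset.exists_mem_eq_sup Finset.univ hne dq
    have hRpos : 0 < R := by
      have := hdR i₁; omega
    obtain ⟨u, v, huv, hvR, hgap, hall⟩ := exists_gap dq hdR ⟨i₀, hi₀.symm⟩ hRpos
    -- the cut: LOW = slots whose centre is within `u` of `x₀`
    let p : ℕ → Prop := fun i => Site.supNorm (cs i - x₀) ≤ u
    have hp0 : p 0 := by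
      show Site.supNorm (cs 0 - x₀) ≤ u
      rw [hcs0 0 rfl, sub_self]
      have : Site.supNorm (0 : Site d) = 0 := Site.supNorm_eq_zero_iff.2 rfl
      omega
    have hhigh : ∀ j ∈ S, ¬p j → (v : ℝ) ≤ ‖cs j - x₀‖ := by
      intro j hj hpj
      have hjn : j < n + 1 := Finset.mem_range.1 hj
      rcases j with _ | j'
      · exact absurd hp0 hpj
      · have hj' : j' < n := by omega
        have e := hcsq (j' + 1) ⟨j', hj'⟩ rfl
        have hdj : ¬(dq ⟨j', hj'⟩ ≤ u) := by
          intro h; apply hpj; show Site.supNorm (cs (j' + 1) - x₀) ≤ u; rw [e]; exact h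
        have hv : v ≤ dq ⟨j', hj'⟩ := (hall ⟨j', hj'⟩).resolve_left hdj
        rw [e, Site.norm_eq_supNorm]
        exact_mod_cast hv
    have hsep : ∀ i ∈ S, ∀ j ∈ S, p i → ¬p j → (((v - u : ℕ) : ℕ) : ℝ) ≤ ‖cs i - cs j‖ := by
      intro i hi j hj hpi hpj
      have hlow : ‖cs i - x₀‖ ≤ u := by
        rw [Site.norm_eq_supNorm]; exact_mod_cast (show Site.supNorm (cs i - x₀) ≤ u from hpi)
      have hv := hhigh j hj hpj
      have htri : ‖cs j - x₀‖ ≤ ‖cs i - cs j‖ + ‖cs i - x₀‖ := by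
        calc ‖cs j - x₀‖ = ‖(cs i - x₀) - (cs i - cs j)‖ := by congr 1; abel
          _ ≤ ‖cs i - x₀‖ + ‖cs i - cs j‖ := norm_sub_le _ _
          _ = _ := add_comm _ _
      rw [Nat.cast_sub huv.le]
      linarith
    have hsplit := abs_mom_sub_mom_mul_mom_le_dim hd hN hK0 hmod hR hdoor h0 hb hμ (S := S) hB1 (fun i _ => hL i)
      (fun i _ => hM i) (fun i _ => hc i) (fun i _ => hnear i) p hsep
    -- both sides of the cut are occupied, the anchor is LOW
    have h0S : (0 : ℕ) ∈ S := Finset.mem_range.2 (Nat.succ_pos n)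
    have hSp : (S.filter p).Nonempty := ⟨0, Finset.mem_filter.2 ⟨h0S, hp0⟩⟩
    have hSn : (S.filter fun i => ¬p i).Nonempty := by
      refine ⟨i₀.1 + 1, Finset.mem_filter.2 ⟨Finset.mem_range.2 (by have := i₀.2; omega), fun hp => ?_⟩⟩
      have e := hcsq (i₀.1 + 1) i₀ rfl
      have hp' : Site.supNorm (cs (i₀.1 + 1) - x₀) ≤ u := hp
      rw [e] at hp'
      have : dq i₀ ≤ u := hp'
      omega
    set ε : ℝ := 4 * (2 * Real.sqrt N) ^ 2 *
      Real.exp (-(dimκ(d, Kc * (b₁ / N)) * ((((v - u : ℕ) - (2 * D' + 2) : ℕ) - 2 : ℕ) : ℝ))) *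
      (((S.card : ℝ) ^ 2 * c₀ * K₀ * (B₀ : ℝ) ^ S.card) ^ 2) with hε
    have hε0 : 0 ≤ ε := by positivity
    have key := abs_ac_le_of_split p (b := fun _ => (B₀ : ℝ)) (fun _ => B₀.2) hε0 hmom1 hmomb hsplit h0S hSp hSn
    have htr : trunc μ F 𝓦 q = ac (mom μ (slots F 𝓦 q)) 0 S := rfl
    rw [htr]
    refine key.trans ?_
    rw [hprodS, hcard]
    -- exponent bookkeeping: `e^{-κ((g-(2D'+2))-2)} ≤ e^{κ(2D'+4)} e^{-κ g} ≤ e^{κ(2D'+4)} ∏ ρ^{l1}`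
    have hexp1 := exp_trunc_sub_le hκ.le (v - u) (2 * D')
    have hsuml1 : ∑ i, (l1 (x₀ - (q i).1) : ℝ) ≤ (d : ℝ) * ((n : ℝ) + 1) ^ 2 * ((v - u : ℕ) : ℝ) := by
      have hg : (R : ℝ) ≤ n * ((v - u : ℕ) : ℝ) := by exact_mod_cast hgap
      calc ∑ i, (l1 (x₀ - (q i).1) : ℝ) ≤ ∑ _i : Fin n, ((d : ℝ) * R : ℝ) :=
            Finset.sum_le_sum fun i _ => (hl1 i).trans
              (mul_le_mul_of_nonneg_left (by exact_mod_cast hdR i) hd0.le)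
        _ = n * ((d : ℝ) * R) := by rw [Finset.sum_const, Finset.card_univ, Fintype.card_fin, nsmul_eq_mul]
        _ ≤ n * ((d : ℝ) * (n * ((v - u : ℕ) : ℝ))) := by gcongr
        _ ≤ (d : ℝ) * ((n : ℝ) + 1) ^ 2 * ((v - u : ℕ) : ℝ) := by
            have : (0 : ℝ) ≤ ((v - u : ℕ) : ℝ) := Nat.cast_nonneg _
            nlinarith [mul_nonneg hd0.le this]
    have hexp2 : Real.exp (-(κ * ((v - u : ℕ) : ℝ))) ≤ ∏ i, ρ ^ l1 (x₀ - (q i).1) := by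
      rw [hρ, prod_exp_neg_pow_eq]
      refine Real.exp_le_exp.2 (neg_le_neg ?_)
      calc κ / ((d : ℝ) * ((n : ℝ) + 1) ^ 2) * ∑ i, (l1 (x₀ - (q i).1) : ℝ)
          ≤ κ / ((d : ℝ) * ((n : ℝ) + 1) ^ 2) * ((d : ℝ) * ((n : ℝ) + 1) ^ 2 * ((v - u : ℕ) : ℝ)) :=
            mul_le_mul_of_nonneg_left hsuml1 hc4.le
        _ = κ * ((v - u : ℕ) : ℝ) := by field_simp
    calc cumBound (n + 1) * ε * (B₀ : ℝ) ^ (n + 1)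
        = cumBound (n + 1) * (B₀ : ℝ) ^ (n + 1) * (C₀ * Q) *
            Real.exp (-(κ * ((((v - u : ℕ) - (2 * D' + 2) : ℕ) - 2 : ℕ) : ℝ))) := by
          rw [hε, hQ, hC₀, hcard, ← hκdef]; ring
      _ ≤ cumBound (n + 1) * (B₀ : ℝ) ^ (n + 1) * (C₀ * Q) *
            (Real.exp (κ * (((2 * D' : ℕ) : ℝ) + 4)) * Real.exp (-(κ * ((v - u : ℕ) : ℝ)))) :=
          mul_le_mul_of_nonneg_left hexp1 (by positivity)
      _ ≤ cumBound (n + 1) * (B₀ : ℝ) ^ (n + 1) * (C₀ * Q) *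
            (Real.exp (κ * (((2 * D' : ℕ) : ℝ) + 4)) * ∏ i, ρ ^ l1 (x₀ - (q i).1)) := by
          gcongr
      _ = cumBound (n + 1) * (B₀ : ℝ) ^ (n + 1) * (C₀ * Real.exp (κ * (((2 * D' : ℕ) : ℝ) + 4)) * Q) *
            ∏ i, ρ ^ l1 (x₀ - (q i).1) := by ring
      _ ≤ A * ∏ i, ρ ^ l1 (x₀ - (q i).1) := by
          refine mul_le_mul_of_nonneg_right ?_ hprod0
          rw [hA]
          refine mul_le_mul_of_nonneg_left (le_add_of_nonneg_left zero_le_one) (by positivity)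

/-! ### §6 Absolute summability over plaquette tuples; the fibre domination -/

/-- ★ **ABSOLUTE SUMMABILITY OF THE TRUNCATED FUNCTIONS OF EVERY ORDER over all plaquette tuples** (`SU(N)`,
`ℤ^d`, modulus hypotheses): with the constants `A, ρ` of `exists_truncated_tree_bound_dim` and
`Z = D_d((1+ρ)/(1−ρ))^d`, for every `0 ≤ b ≤ b₁` and every DLR state `μ` at `b`,
`q ↦ u_{n+1}(F; W_{q 0}; …; W_{q (n−1)})_μ` is summable over `(ZdPlaquette d)^n` and `Σ'_q |u_{n+1}| ≤ A Zⁿ` — the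
`n`-th order static response of every local observable is FINITE on the window, uniformly in the coupling. -/
theorem summable_truncated_dim (hd : 2 ≤ d) (hN : 1 ≤ N) {R Kc b₁ : ℝ} (hK0 : 0 ≤ Kc)
    (hmod : OneLinkKRModulus N R Kc) (hR : b₁ / N * (2 * ((d : ℝ) - 1)) ≤ R) (hdoor : doorPoly d (Kc * (b₁ / N)) < 1)
    {F : LGConfig d (Matrix.specialUnitaryGroup (Fin N) ℂ) → ℝ} {Λ : Finset (ZdEdge d)} {K : ℝ≥0}
    (hF : IsLipschitzCylinder (fundamentalRep (Fin N)) F Λ K)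
    {x₀ : Site d} {D : ℕ} (hD : ∀ e ∈ Λ, ‖e.1 - x₀‖ ≤ D) (n : ℕ) :
    ∃ A ρ : ℝ, 0 ≤ A ∧ 0 ≤ ρ ∧ ρ < 1 ∧ ∀ ⦃b : ℝ⦄, 0 ≤ b → b ≤ b₁ →
      ∀ ⦃μ : Measure (LGConfig d (Matrix.specialUnitaryGroup (Fin N) ℂ))⦄,
        μ ∈ ymGibbsMeasures (d := d) (fundamentalRep (Fin N)) b →
      (∀ q : Fin n → ZdPlaquette d, |trunc μ F 𝓦 q| ≤ A * ∏ i, ρ ^ l1 (x₀ - (q i).1)) ∧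
      Summable (fun q : Fin n → ZdPlaquette d => trunc μ F 𝓦 q) ∧
      ∑' q : Fin n → ZdPlaquette d, |trunc μ F 𝓦 q| ≤ A * (numOrient d * ((1 + ρ) / (1 - ρ)) ^ d) ^ n := by
  classical
  obtain ⟨A, ρ, hA0, hρ0, hρ1, h⟩ := exists_truncated_tree_bound_dim hd hN hK0 hmod hR hdoor hF hD n
  refine ⟨A, ρ, hA0, hρ0, hρ1, fun b h0 hb μ hμ => ⟨h h0 hb hμ, ?_⟩⟩
  exact summable_pi_of_abs_le_prod hA0 (fun r => pow_nonneg hρ0 _) (sum_pow_l1_plaquette_le_dim hρ0 hρ1 x₀)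
    (h h0 hb hμ)

/-- ★ **THE FIBRE DOMINATION** (`SU(N)`, `ℤ^d`): with the order-`(n+1)` constants `A, ρ` and `Z = D_d((1+ρ)/(1−ρ))^d`,
for every `0 ≤ b ≤ b₁`, every DLR state `μ` at `b` and every `q : Fin n → ZdPlaquette d`, the fibre
`r ↦ u_{n+2}(F; W_{q 0}; …; W_{q (n−1)}; W_r)_μ` is summable with
`Σ'_r |u_{n+2}(…; W_r)| ≤ A Z ∏_i ρ^{‖x₀ − x_{q i}‖₁}` — a bound summable in `q`, uniform in the coupling: the
domination under which the order-`n` response series is differentiated termwise (file `CouplingSmoothDim`). -/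
theorem tsum_abs_truncated_snoc_le_dim (hd : 2 ≤ d) (hN : 1 ≤ N) {R Kc b₁ : ℝ} (hK0 : 0 ≤ Kc)
    (hmod : OneLinkKRModulus N R Kc) (hR : b₁ / N * (2 * ((d : ℝ) - 1)) ≤ R) (hdoor : doorPoly d (Kc * (b₁ / N)) < 1)
    {F : LGConfig d (Matrix.specialUnitaryGroup (Fin N) ℂ) → ℝ} {Λ : Finset (ZdEdge d)} {K : ℝ≥0}
    (hF : IsLipschitzCylinder (fundamentalRep (Fin N)) F Λ K)
    {x₀ : Site d} {D : ℕ} (hD : ∀ e ∈ Λ, ‖e.1 - x₀‖ ≤ D) (n : ℕ) :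
    ∃ A ρ : ℝ, 0 ≤ A ∧ 0 ≤ ρ ∧ ρ < 1 ∧ ∀ ⦃b : ℝ⦄, 0 ≤ b → b ≤ b₁ →
      ∀ ⦃μ : Measure (LGConfig d (Matrix.specialUnitaryGroup (Fin N) ℂ))⦄,
        μ ∈ ymGibbsMeasures (d := d) (fundamentalRep (Fin N)) b →
      ∀ q : Fin n → ZdPlaquette d,
        Summable (fun r : ZdPlaquette d => trunc μ F 𝓦 (Fin.snoc q r : Fin (n + 1) → ZdPlaquette d)) ∧
        ∑' r : ZdPlaquette d, |trunc μ F 𝓦 (Fin.snoc q r : Fin (n + 1) → ZdPlaquette d)| ≤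
          A * (numOrient d * ((1 + ρ) / (1 - ρ)) ^ d) * ∏ i, ρ ^ l1 (x₀ - (q i).1) := by
  classical
  obtain ⟨A, ρ, hA0, hρ0, hρ1, h⟩ := exists_truncated_tree_bound_dim hd hN hK0 hmod hR hdoor hF hD (n + 1)
  refine ⟨A, ρ, hA0, hρ0, hρ1, fun b h0 hb μ hμ q => ?_⟩
  set c : ℝ := A * ∏ i, ρ ^ l1 (x₀ - (q i).1) with hc
  have hc0 : 0 ≤ c := mul_nonneg hA0 (Finset.prod_nonneg fun i _ => pow_nonneg hρ0 _)
  have hpt : ∀ r : ZdPlaquette d,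
      |trunc μ F 𝓦 (Fin.snoc q r : Fin (n + 1) → ZdPlaquette d)| ≤ c * ρ ^ l1 (x₀ - r.1) := by
    intro r
    have hb' := h h0 hb hμ (Fin.snoc q r)
    rw [Fin.prod_univ_castSucc] at hb'
    simp only [Fin.snoc_castSucc, Fin.snoc_last] at hb'
    rw [hc, mul_assoc]
    exact hb'
  obtain ⟨hs, hle⟩ := summable_and_tsum_base_le (d := d) hc0 hρ0 hρ1 x₀
  have hsum : Summable fun r : ZdPlaquette d =>
      |trunc μ F 𝓦 (Fin.snoc q r : Fin (n + 1) → ZdPlaquette d)| :=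
    Summable.of_nonneg_of_le (fun r => abs_nonneg _) hpt hs
  refine ⟨hsum.of_abs, (hsum.tsum_le_tsum hpt hs).trans ?_⟩
  calc ∑' r : ZdPlaquette d, c * ρ ^ l1 (x₀ - r.1) ≤ c * (numOrient d * ((1 + ρ) / (1 - ρ)) ^ d) := hle
    _ = A * (numOrient d * ((1 + ρ) / (1 - ρ)) ^ d) * ∏ i, ρ ^ l1 (x₀ - (q i).1) := by rw [hc]; ring

end Summit.Ventures.YMGap.CouplingResponse

end
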